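import Summits.QuantumFields.YangMills.Theorems.BalabanUVNodesSpineReadingOfRecord13CoPHKComponentSizeBlocksFreshPolymer

/-!
# THE N20 PRODUCT SOCKET, ONE STEP AT A TIME: on NODE 00's sequence index the JOINT-FRESH PRODUCT letters of gen 35 (`…BlocksFreshProduct`, hPA ∕ hPB) FOLLOW
# from (T) a CLASS-WISE TELESCOPING law of the (2.18) class weights along the run's own levels and (O) ONE-STEP letters — one level, one step, lower-level
# cubes as the environment — by induction on the level (successive conditioning ∕ the tower property on the index of record)

Cell `pub-ymgap`, YM-PLAN Track A (HUMAN RULING D-0062; width push D-0149); seat `pub-ymgap-dag-n20-d` (R134 (a) N20 NE7b s3 = the U5d ∕ `crOfRecord₁₃` lineage, its declarer)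
gen 37; companion of `…CoPHKComponentSizeBlocksFreshProduct` (gen 35: ★★★ `relWeightBound_card_of_jointFreshSeqLetters_id_supNear`, hypotheses hPA ∕ hPB),
`…CoPHKComponentSizeBlocksFreshPolymer` (gen 36: the age-geometric schedule, ★★★ `relWeightBound_card_of_ageJointFreshSeqLetters_id_supNear`), of
`B14Eq218SeqSucc` (`Seq.restrict`, `Seq.sum_seq_succ_fiber`) and `Node00/TwoRunSiteKey` (`truncShift_Λ`); the finite Markov-chain model of the same induction is
`Literature/Probability/MarkovChains/PathEventTower` (gen 37, `sum_boxLists_range_le_prod_mul`).  `--kind proof --supports stmt-QuantumFields-27366 --as helper` (K3⁸);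
COUNT-NEUTRAL; THEOREMS ONLY (0 `def`).  [III] = [Balaban1988Convergent]; [LF-II] = [Balaban1989LargeFieldII].

WHY.  Gen 35's product letter asks, for a ϱ-separated block family and an assignment `a : b ↦ (i_b, c_b)` of a fresh cause to each block, that the level-`K₀+K` classes
«every `c_b` fresh at `i_b`» weigh at most `Π_b ζ K j i_b` times the total — a MULTI-LEVEL statement.  [LF-II] collects such products ONE STEP AT A TIME ((1.79) p. 383
«a product of factors coming from the successive renormalization steps»; (1.89) p. 387 the per-step operator bound).  On the index of record the mechanism is the TOWER:
if (T) the class weights TELESCOPE class-wise between consecutive levels — `Σ_{s′ : s′.init = π} w_{m+1}(s′) = w_m(π)` for every level-`m` sequence `π` (the (0.4)∕E1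
identity PER SEQUENCE FIBRE: the partition of unity of the step, `TStepOfRecord.IsStepUnity`, carried through the transport and an 𝐑-step of record that is the identity on
live slots, `Record12LiveSelector`) — then every class of top-level sequences DETERMINED BY ITS RESTRICTION to length `k′` weighs exactly its level-`k′` weight (§1,
★ `sum_filter_eq_of_telescoping`, generic over `B14.Eq218Concrete.Seq`); and the fresh events of the cubes of `a` at levels `≤ i` ARE determined by the restriction to
length `i` (`Seq.restrict_Λ`; run B: `truncShift_Λ`).  So if (O) at every level `i ∈ [1, j]` the level-`i` classes «cubes of level `i` fresh ∧ lower cubes fresh» weigh at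
most `(Π_{i_b = i} ζ K j i)` × the level-`i` classes «lower cubes fresh» (ONE step, ONE level; the lower cubes are the environment), induction on `i` — up to the top by
§1, one-step letter, back down by §1 — gives gen 35's hPA ∕ hPB (§2 generic ★★ `sum_le_prod_mul_of_oneStepLetters`; §3 ★★ `jointFreshSeqLetters_A_of_oneStep ∕ _B_of_oneStep`) and the faces follow verbatim
(companion `…BlocksFreshTowerFaces`: ★★★ `relWeightBound_card_of_oneStepFreshLetters_id_supNear` with gen 35's numerics, `…_of_ageOneStepFreshLetters_id_supNear` with
gen 36's age-geometric schedule and `W K = 2^{−(K+1)}`), under the one extra side condition `jcut K ≤ K₀ + K` (no level above the top).  AFTER THIS FILE the supplier owes, per run: (T) — STRUCTURAL, no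
estimate (unity + Fubini + the live pin); and (O) — ANALYTIC but ONE-STEP: [LF-II] (1.89)'s KIND read as a RATIO against the same environment's unrestricted step
(local conditional stability at ONE step, where Theorem 1 [III]'s small-field form of the level-`i` slots near the fresh cubes is spent); several same-level cubes = the
joint one-step letter ((1.79) is a product over the components created in one step).
HONEST FRAMING.  [bookkeeping] finite-sum algebra BY NAME on def-R's index; (T) and (O) are HYPOTHESES inhabited for no family today ((T) is nobody's theorem beyond
level 0 — E1 —; (O) is NOT PRINTED as a statement about the (2.18) class weights); NO weight is bounded, NO estimate proved; nothing of Bałaban's asserted; NE7 ∕ NE7b ∕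
NE7c NOT PRINTED for `d = 4` ∕ NOT proved; no `Provisos₁₃CoPH` inhabitant claimed (K0⁷ OPEN); K3⁸ v7 untouched; N19 ∕ N20 ∕ N21 ∕ N27 NOT discharged; counts UNMOVED
(typed 28∕28 · discharged 8∕27); one finite four-torus programme at fixed `ε` — NOT ℝ⁴, NOT OS, NOT a mass gap, NOT the Clay problem.  No `def`, no `instance`, no
`notation`, no `sorry`; no decl below carries a cite tag.
-/

noncomputable section

open scoped BigOperators
open Finset

namespace YMDAG.UVSplit

open Literature.MathematicalPhysics.QuantumFieldTheory.Balaban1983to89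
open Literature.MathematicalPhysics.QuantumFieldTheory.Balaban1983to89.T4Continuum
open Literature.MathematicalPhysics.QuantumFieldTheory.Balaban1983to89.Node00
open Literature.MathematicalPhysics.QuantumFieldTheory.Balaban1983to89.B14.Eq218Concrete
open Literature.MathematicalPhysics.QuantumFieldTheory.Balaban1983to89.B5Eq118OneStroke (iterBlockOf iterBlock)
open T4WeightBudget (RelWeightBound)

/-! ## §1 Class-wise telescoping ⇒ every class determined by a restriction weighs its lower-level weight (generic over `Seq`) -/

section Telescoping

variable {α : Type*} [Finite α] {D : ℕ → Set (Set α)}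

open scoped Classical in
/-- ★ **CLASS-WISE TELESCOPING ⇒ CONSERVATION OF RESTRICTION-DETERMINED CLASSES** (generic over def-T's index `Seq D k`): if between every pair of consecutive levels
`m, m+1` with `k′ ≤ m < k` the weights telescope on the fibres of `init` — `Σ_{s′ : s′.init = π} w (m+1) s′ = w m π` — then a level-`k` class `{s : E′ s}` that is DECIDED BY
THE RESTRICTION to length `k′` (`E′ s ↔ E (s.restrict _)`) weighs exactly the level-`k′` class `{π : E π}` (`Seq.sum_seq_succ_fiber`, `Seq.restrict_restrict`, induction
on `k`; any decidability instances on the two classes).  The tower property on the index: a class decided at level `k′` keeps its weight through every later step.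
[bookkeeping] -/
theorem sum_filter_eq_of_telescoping (w : (m : ℕ) → Seq D m → ℝ) {k' k : ℕ} (hk : k' ≤ k)
    (htel : ∀ m, k' ≤ m → m < k → ∀ π : Seq D m,
      ∑ s' ∈ Finset.univ.filter (fun s' : Seq D (m + 1) => s'.init = π), w (m + 1) s' = w m π)
    (E : Seq D k' → Prop) [DecidablePred E] (E' : Seq D k → Prop) [DecidablePred E'] (hE : ∀ s, E' s ↔ E (s.restrict hk)) :
    ∑ s ∈ Finset.univ.filter E', w k s = ∑ π ∈ Finset.univ.filter E, w k' π := by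
  induction k, hk using Nat.le_induction with
  | base =>
    refine Finset.sum_congr (Finset.filter_congr fun s _ => ?_) fun _ _ => rfl
    rw [hE s, Seq.restrict_self]
  | succ k hk ih =>
    have hres : ∀ s' : Seq D (k + 1), s'.restrict (hk.trans (Nat.le_succ k)) = s'.init.restrict hk := by
      intro s'
      rw [Seq.init_eq_restrict, Seq.restrict_restrict]
    have ih' := ih (fun m hm hmk => htel m hm (hmk.trans (Nat.lt_succ_self k))) (fun π => E (π.restrict hk)) fun _ => Iff.rfl
    rw [Finset.sum_filter, Seq.sum_seq_succ_fiber, ← ih', Finset.sum_filter]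
    refine Finset.sum_congr rfl fun π _ => ?_
    by_cases hEπ : E (π.restrict hk)
    · rw [if_pos hEπ, ← htel k hk (Nat.lt_succ_self k) π]
      refine Finset.sum_congr rfl fun s' hs' => ?_
      have hinit : s'.init = π := (Finset.mem_filter.1 hs').2
      have hs : E' s' := (hE s').2 (by rw [hres s', hinit]; exact hEπ)
      rw [if_pos hs]
    · rw [if_neg hEπ]
      refine Finset.sum_eq_zero fun s' hs' => ?_
      have hinit : s'.init = π := (Finset.mem_filter.1 hs').2
      have hs : ¬ E' s' := fun h => hEπ (by rw [← hinit, ← hres s']; exact (hE s').1 h)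
      rw [if_neg hs]

end Telescoping

/-! ## §2 The tower on the index: one-step letters at the pinned levels multiply (generic over `Seq`) -/

section Tower

variable {α : Type*} [Finite α] {D : ℕ → Set (Set α)}

open scoped Classical in
/-- ★★ **SUCCESSIVE CONDITIONING ON THE INDEX** (generic over def-T's index `Seq D k`).  Data: weights `w m` on every level with the class-wise telescoping law below the
top level `kt`; a finite set `P` of PINS, each with a level `ℓ x ∈ [1, j]` and a rate `ζ x ≥ 0`; for every length `m` a predicate `fresh m s x` («pin `x` is fresh in the
length-`m` sequence `s`») DECIDED BY THE RESTRICTION to any length `n ≥ len (ℓ x)` (`len` = a monotone read-out length: `len i = i` when the level-`i` event reads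
`Λ_i, Λ_{i−1}`, `len i = i + 1` when it reads one level up, as run B's truncation does); `len j ≤ kt`; and the CLASSES `cls m n` = «every pin of level `≤ n` fresh in the length-`m` sequence» (given as finite
sets with their membership law, so that no decidability instance is fixed here).  ONE-STEP LETTERS: at every level `i ∈ [1, j]`, on the sequences of length `len i`, the
class `cls (len i) i` weighs at most `(Π_{ℓ x = i} ζ x)` times the class `cls (len i) (i−1)` (the pins of level `< i` are the environment).  CONCLUSION: the top class
`cls kt j` («every pin fresh») weighs at most `(Π_{x ∈ P} ζ x)` times the total top weight.  Proof: induction on the level `n` — `cls kt (n+1)` is decided at length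
`len (n+1)`, so by `sum_filter_eq_of_telescoping` it weighs its length-`len (n+1)` weight, the letter peels the pins of level `n+1`, and `cls (len (n+1)) n` goes back to the
top by the same identity. [bookkeeping] -/
theorem sum_le_prod_mul_of_oneStepLetters (w : (m : ℕ) → Seq D m → ℝ) {kt j : ℕ} (len : ℕ → ℕ)
    (hlen : ∀ a b, a ≤ b → len a ≤ len b) (hj : len j ≤ kt)
    (htel : ∀ m, m < kt → ∀ π : Seq D m,
      ∑ s' ∈ Finset.univ.filter (fun s' : Seq D (m + 1) => s'.init = π), w (m + 1) s' = w m π)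
    {X : Type*} (P : Finset X) (ℓ : X → ℕ) (hℓ : ∀ x ∈ P, 1 ≤ ℓ x ∧ ℓ x ≤ j) (fresh : (m : ℕ) → Seq D m → X → Prop)
    (hcompat : ∀ {m n : ℕ} (h : n ≤ m) (s : Seq D m), ∀ x ∈ P, len (ℓ x) ≤ n → (fresh m s x ↔ fresh n (s.restrict h) x))
    {ζ : X → ℝ} (hζ : ∀ x ∈ P, 0 ≤ ζ x) (cls : (m n : ℕ) → Finset (Seq D m))
    (hcls : ∀ m n (s : Seq D m), s ∈ cls m n ↔ ∀ x ∈ P, ℓ x ≤ n → fresh m s x)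
    (hO : ∀ i ∈ Finset.Icc 1 j,
      ∑ π ∈ cls (len i) i, w (len i) π ≤ (∏ x ∈ P.filter (fun x => ℓ x = i), ζ x) * ∑ π ∈ cls (len i) (i - 1), w (len i) π) :
    ∑ s ∈ cls kt j, w kt s ≤ (∏ x ∈ P, ζ x) * ∑ s, w kt s := by
  classical
  -- a class given by its membership law is the filter of that law
  have hfilt : ∀ m n, cls m n = Finset.univ.filter (fun s : Seq D m => ∀ x ∈ P, ℓ x ≤ n → fresh m s x) := by
    intro m n
    ext s
    simp only [Finset.mem_filter, Finset.mem_univ, true_and, hcls]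
  -- the induction on the level `n ≤ j`
  have key : ∀ n, n ≤ j → ∑ s ∈ cls kt n, w kt s ≤ (∏ x ∈ P.filter (fun x => ℓ x ≤ n), ζ x) * ∑ s, w kt s := by
    intro n hn
    induction n with
    | zero =>
      have hempty : P.filter (fun x => ℓ x ≤ 0) = ∅ := by
        refine Finset.filter_eq_empty_iff.2 fun x hx h => ?_
        have := (hℓ x hx).1
        omega
      have hall : cls kt 0 = Finset.univ := by
        rw [hfilt]
        refine Finset.filter_true_of_mem fun s _ x hx h => ?_
        have := (hℓ x hx).1
        omega
      rw [hempty, Finset.prod_empty, one_mul, hall]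
    | succ n ih =>
      have hn' : n ≤ j := (Nat.le_succ n).trans hn
      have hnK : len (n + 1) ≤ kt := (hlen _ _ hn).trans hj
      -- up to length `len (n + 1)` by telescoping
      have hup : ∑ s ∈ cls kt (n + 1), w kt s = ∑ π ∈ cls (len (n + 1)) (n + 1), w (len (n + 1)) π := by
        rw [hfilt, hfilt]
        exact sum_filter_eq_of_telescoping w hnK (fun m _ hm π => htel m hm π)
          (fun π => ∀ x ∈ P, ℓ x ≤ n + 1 → fresh (len (n + 1)) π x) _
          fun s => forall₂_congr fun x hx => imp_congr_right fun hxn => hcompat hnK s x hx (hlen _ _ hxn)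
      -- back down from length `len (n + 1)` by telescoping
      have hdown : ∑ π ∈ cls (len (n + 1)) (n + 1 - 1), w (len (n + 1)) π = ∑ s ∈ cls kt n, w kt s := by
        rw [Nat.add_sub_cancel, hfilt, hfilt]
        exact (sum_filter_eq_of_telescoping w hnK (fun m _ hm π => htel m hm π)
          (fun π => ∀ x ∈ P, ℓ x ≤ n → fresh (len (n + 1)) π x) _
          fun s => forall₂_congr fun x hx => imp_congr_right fun hxn =>
            hcompat hnK s x hx ((hlen _ _ hxn).trans (hlen _ _ (Nat.le_succ n)))).symm
      -- the product splits off the pins of level `n + 1`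
      have hprod : (∏ x ∈ P.filter (fun x => ℓ x ≤ n + 1), ζ x) =
          (∏ x ∈ P.filter (fun x => ℓ x = n + 1), ζ x) * ∏ x ∈ P.filter (fun x => ℓ x ≤ n), ζ x := by
        rw [← Finset.prod_union (Finset.disjoint_filter.2 fun x _ h1 h2 => by omega)]
        refine Finset.prod_congr ?_ fun _ _ => rfl
        ext x
        simp only [Finset.mem_filter, Finset.mem_union]
        constructor
        · rintro ⟨hx, h⟩
          by_cases h' : ℓ x = n + 1
          · exact Or.inl ⟨hx, h'⟩
          · exact Or.inr ⟨hx, by omega⟩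
        · rintro (⟨hx, h⟩ | ⟨hx, h⟩)
          · exact ⟨hx, h.le⟩
          · exact ⟨hx, h.trans (Nat.le_succ n)⟩
      have hprod0 : 0 ≤ ∏ x ∈ P.filter (fun x => ℓ x = n + 1), ζ x :=
        Finset.prod_nonneg fun x hx => hζ x (Finset.mem_filter.1 hx).1
      calc ∑ s ∈ cls kt (n + 1), w kt s
            = ∑ π ∈ cls (len (n + 1)) (n + 1), w (len (n + 1)) π := hup
        _ ≤ (∏ x ∈ P.filter (fun x => ℓ x = n + 1), ζ x) * ∑ π ∈ cls (len (n + 1)) (n + 1 - 1), w (len (n + 1)) π :=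
            hO (n + 1) (Finset.mem_Icc.2 ⟨Nat.succ_pos n, hn⟩)
        _ = (∏ x ∈ P.filter (fun x => ℓ x = n + 1), ζ x) * ∑ s ∈ cls kt n, w kt s := by rw [hdown]
        _ ≤ (∏ x ∈ P.filter (fun x => ℓ x = n + 1), ζ x) * ((∏ x ∈ P.filter (fun x => ℓ x ≤ n), ζ x) * ∑ s, w kt s) :=
            mul_le_mul_of_nonneg_left (ih hn') hprod0
        _ = (∏ x ∈ P.filter (fun x => ℓ x ≤ n + 1), ζ x) * ∑ s, w kt s := by rw [hprod, mul_assoc]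
  -- at `n = j` every pin is of level `≤ j`
  have hfin := key j le_rfl
  rwa [Finset.filter_true_of_mem fun x hx => (hℓ x hx).2] at hfin

end Tower

/-! ## §3 Gen 35's joint-fresh product letters (hPA ∕ hPB) from telescoping + one-step letters, per run -/

section Runs

variable {F : T4Family} {N : ℕ} [NeZero N]
variable (θ : Stage13HParams F N) (hP : θ.Provisos₁₃CoPH F N) (K₀ : ℕ) (g₀ : ℕ → ℝ) (os : List (ULoop F)) (lv : ℕ → ℕ → ℕ)

open scoped Classical in
/-- ★★ **RUN A — THE JOINT-FRESH PRODUCT LETTER FROM TELESCOPING + ONE-STEP LETTERS.**  Fix the step `K`, source `t`, level `j ≤ K₀ + K`, a finite block family `B`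
at level `lv K j` with an assignment `a : b ↦ (i_b, c_b)` of levels `i_b ∈ [1, j]` and level-`lv K i_b` cubes, and rates `ζ K j · ≥ 0`.  IF (T_A) run A's (2.18) class
weights telescope class-wise between consecutive levels below `K₀ + K`, and (O_A) at every level `i ∈ [1, j]` the level-`i` classes «every cube of `a` of level `≤ i` fresh»
weigh at most `(Π_{b : i_b = i} ζ K j i_b)` times the level-`i` classes «every cube of `a` of level `< i` fresh» (fresh at `i_b`: `c_b ⊆ (Λ_{i_b})ᶜ`, and `c_b ⊆ Λ_{i_b−1}` when
`i_b ≥ 2`, READ ON THE LEVEL-`i` SEQUENCE), THEN the top-level class «every cube of `a` fresh» weighs at most `(Π_b ζ K j i_b)` times run A's total (2.18) weight — gen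
35's hPA for `(B, a)`.  §2 with read-out length `len i = i` (`Seq.restrict_Λ`). [bookkeeping] -/
theorem jointFreshSeqLetters_A_of_oneStep (K : ℕ) (t : ℝ) {j : ℕ} (hjK : j ≤ K₀ + K) (B : Finset (Site (F.P (K₀ + K)) (lv K j)))
    {a : (b : Site (F.P (K₀ + K)) (lv K j)) → b ∈ B → (Σ i : ℕ, Site (F.P (K₀ + K)) (lv K i))}
    (ha : ∀ b (hb : b ∈ B), (a b hb).1 ∈ Finset.Icc 1 j) {ζ : ℕ → ℕ → ℕ → ℝ} (hζ0 : ∀ i, 0 ≤ ζ K j i)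
    (hT : ∀ m, m < K₀ + K → ∀ π : SeqOfRecord F θ.ν θ.τ9.M (histA₁₃ θ K₀ g₀ K) (K₀ + K) m,
      ∑ s' ∈ Finset.univ.filter (fun s' : SeqOfRecord F θ.ν θ.τ9.M (histA₁₃ θ K₀ g₀ K) (K₀ + K) (m + 1) => s'.init = π),
        classWeightOfDatum₉ F N θ.toStage9Params (datumOfRecord₁₃CoPH F N θ hP) g₀ os (runA₁₃ F K₀ g₀ K) (histA₁₃ θ K₀ g₀ K) (m + 1) t s' =
      classWeightOfDatum₉ F N θ.toStage9Params (datumOfRecord₁₃CoPH F N θ hP) g₀ os (runA₁₃ F K₀ g₀ K) (histA₁₃ θ K₀ g₀ K) m t π)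
    (hO : ∀ i ∈ Finset.Icc 1 j,
      ∑ π ∈ Finset.univ.filter (fun π : SeqOfRecord F θ.ν θ.τ9.M (histA₁₃ θ K₀ g₀ K) (K₀ + K) i =>
          ∀ x ∈ B.attach, (a x.1 x.2).1 ≤ i →
            (↑(iterBlock (lv K (a x.1 x.2).1) (a x.1 x.2).2) : Set (Site (F.P (K₀ + K)) 0)) ⊆ (π.Λ (a x.1 x.2).1)ᶜ ∧
            (2 ≤ (a x.1 x.2).1 → (↑(iterBlock (lv K (a x.1 x.2).1) (a x.1 x.2).2) : Set (Site (F.P (K₀ + K)) 0)) ⊆ π.Λ ((a x.1 x.2).1 - 1))),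
        classWeightOfDatum₉ F N θ.toStage9Params (datumOfRecord₁₃CoPH F N θ hP) g₀ os (runA₁₃ F K₀ g₀ K) (histA₁₃ θ K₀ g₀ K) i t π ≤
      (∏ x ∈ B.attach.filter (fun x => (a x.1 x.2).1 = i), ζ K j (a x.1 x.2).1) *
        ∑ π ∈ Finset.univ.filter (fun π : SeqOfRecord F θ.ν θ.τ9.M (histA₁₃ θ K₀ g₀ K) (K₀ + K) i =>
            ∀ x ∈ B.attach, (a x.1 x.2).1 < i →
              (↑(iterBlock (lv K (a x.1 x.2).1) (a x.1 x.2).2) : Set (Site (F.P (K₀ + K)) 0)) ⊆ (π.Λ (a x.1 x.2).1)ᶜ ∧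
              (2 ≤ (a x.1 x.2).1 → (↑(iterBlock (lv K (a x.1 x.2).1) (a x.1 x.2).2) : Set (Site (F.P (K₀ + K)) 0)) ⊆ π.Λ ((a x.1 x.2).1 - 1))),
          classWeightOfDatum₉ F N θ.toStage9Params (datumOfRecord₁₃CoPH F N θ hP) g₀ os (runA₁₃ F K₀ g₀ K) (histA₁₃ θ K₀ g₀ K) i t π) :
    ∑ s ∈ Finset.univ.filter (fun s : SeqOfRecord F θ.ν θ.τ9.M (histA₁₃ θ K₀ g₀ K) (K₀ + K) (K₀ + K) =>
        ∀ x ∈ B.attach, (↑(iterBlock (lv K (a x.1 x.2).1) (a x.1 x.2).2) : Set (Site (F.P (K₀ + K)) 0)) ⊆ (s.Λ (a x.1 x.2).1)ᶜ ∧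
          (2 ≤ (a x.1 x.2).1 → (↑(iterBlock (lv K (a x.1 x.2).1) (a x.1 x.2).2) : Set (Site (F.P (K₀ + K)) 0)) ⊆ s.Λ ((a x.1 x.2).1 - 1))),
      classWeightOfDatum₉ F N θ.toStage9Params (datumOfRecord₁₃CoPH F N θ hP) g₀ os (runA₁₃ F K₀ g₀ K) (histA₁₃ θ K₀ g₀ K) (K₀ + K) t s ≤
    (∏ x ∈ B.attach, ζ K j (a x.1 x.2).1) * ∑ s : SeqOfRecord F θ.ν θ.τ9.M (histA₁₃ θ K₀ g₀ K) (K₀ + K) (K₀ + K),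
      classWeightOfDatum₉ F N θ.toStage9Params (datumOfRecord₁₃CoPH F N θ hP) g₀ os (runA₁₃ F K₀ g₀ K) (histA₁₃ θ K₀ g₀ K) (K₀ + K) t s := by
  have ha1 : ∀ x ∈ B.attach, 1 ≤ (a x.1 x.2).1 ∧ (a x.1 x.2).1 ≤ j := fun x _ => Finset.mem_Icc.1 (ha x.1 x.2)
  -- the pins' fresh predicate, read on a run-A sequence of any length through its `Λ`
  let fr : (m : ℕ) → SeqOfRecord F θ.ν θ.τ9.M (histA₁₃ θ K₀ g₀ K) (K₀ + K) m → {x // x ∈ B} → Prop := fun m s x =>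
    (↑(iterBlock (lv K (a x.1 x.2).1) (a x.1 x.2).2) : Set (Site (F.P (K₀ + K)) 0)) ⊆ (s.Λ (a x.1 x.2).1)ᶜ ∧
      (2 ≤ (a x.1 x.2).1 → (↑(iterBlock (lv K (a x.1 x.2).1) (a x.1 x.2).2) : Set (Site (F.P (K₀ + K)) 0)) ⊆ s.Λ ((a x.1 x.2).1 - 1))
  have hgen := sum_le_prod_mul_of_oneStepLetters (j := j) (kt := K₀ + K)
    (fun m (s : SeqOfRecord F θ.ν θ.τ9.M (histA₁₃ θ K₀ g₀ K) (K₀ + K) m) =>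
      classWeightOfDatum₉ F N θ.toStage9Params (datumOfRecord₁₃CoPH F N θ hP) g₀ os (runA₁₃ F K₀ g₀ K) (histA₁₃ θ K₀ g₀ K) m t s)
    (fun i => i) (fun _ _ h => h) hjK hT B.attach (fun x => (a x.1 x.2).1) ha1 fr
    (fun hnm s x hx hxn => by
      -- decided by the restriction to length `n ≥ i_b`
      have h1 := (ha1 x hx).1
      simp only [fr]
      rw [Seq.restrict_Λ hnm s h1 hxn]
      by_cases h2 : 2 ≤ (a x.1 x.2).1
      · rw [Seq.restrict_Λ hnm s (by omega) (by omega)]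
      · simp only [h2, false_implies])
    (fun x _ => hζ0 (a x.1 x.2).1)
    (fun m n => Finset.univ.filter (fun s : SeqOfRecord F θ.ν θ.τ9.M (histA₁₃ θ K₀ g₀ K) (K₀ + K) m =>
      ∀ x ∈ B.attach, (a x.1 x.2).1 ≤ n → fr m s x))
    (fun m n s => by simp only [Finset.mem_filter, Finset.mem_univ, true_and])
    (fun i hi => by
      -- the one-step letter at level `i`: «level `< i`» is «level `≤ i − 1`» for `i ≥ 1`
      have hi1 : 1 ≤ i := (Finset.mem_Icc.1 hi).1
      have hL : Finset.univ.filter (fun π : SeqOfRecord F θ.ν θ.τ9.M (histA₁₃ θ K₀ g₀ K) (K₀ + K) i =>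
            ∀ x ∈ B.attach, (a x.1 x.2).1 ≤ i →
              (↑(iterBlock (lv K (a x.1 x.2).1) (a x.1 x.2).2) : Set (Site (F.P (K₀ + K)) 0)) ⊆ (π.Λ (a x.1 x.2).1)ᶜ ∧
              (2 ≤ (a x.1 x.2).1 → (↑(iterBlock (lv K (a x.1 x.2).1) (a x.1 x.2).2) : Set (Site (F.P (K₀ + K)) 0)) ⊆ π.Λ ((a x.1 x.2).1 - 1))) =
          Finset.univ.filter (fun π : SeqOfRecord F θ.ν θ.τ9.M (histA₁₃ θ K₀ g₀ K) (K₀ + K) i =>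
            ∀ x ∈ B.attach, (a x.1 x.2).1 ≤ i → fr i π x) :=
        Finset.filter_congr fun π _ => forall₂_congr fun x _ => Iff.rfl
      have hR : Finset.univ.filter (fun π : SeqOfRecord F θ.ν θ.τ9.M (histA₁₃ θ K₀ g₀ K) (K₀ + K) i =>
            ∀ x ∈ B.attach, (a x.1 x.2).1 < i →
              (↑(iterBlock (lv K (a x.1 x.2).1) (a x.1 x.2).2) : Set (Site (F.P (K₀ + K)) 0)) ⊆ (π.Λ (a x.1 x.2).1)ᶜ ∧
              (2 ≤ (a x.1 x.2).1 → (↑(iterBlock (lv K (a x.1 x.2).1) (a x.1 x.2).2) : Set (Site (F.P (K₀ + K)) 0)) ⊆ π.Λ ((a x.1 x.2).1 - 1))) =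
          Finset.univ.filter (fun π : SeqOfRecord F θ.ν θ.τ9.M (histA₁₃ θ K₀ g₀ K) (K₀ + K) i =>
            ∀ x ∈ B.attach, (a x.1 x.2).1 ≤ i - 1 → fr i π x) :=
        Finset.filter_congr fun π _ => forall₂_congr fun x _ => by
          constructor
          · exact fun h hx => h (by omega)
          · exact fun h hx => h (by omega)
      rw [← hL, ← hR]
      exact hO i hi)
  -- the top class: every pin is of level `≤ j`
  refine le_trans (le_of_eq (Finset.sum_congr (Finset.filter_congr fun s _ => ?_) fun _ _ => rfl)) hgen
  exact forall₂_congr fun x hx => ⟨fun h _ => h, fun h => h (ha1 x hx).2⟩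

open scoped Classical in
/-- ★★ **RUN B — THE JOINT-FRESH PRODUCT LETTER FROM TELESCOPING + ONE-STEP LETTERS** (`0 < M`): the same over run B's index (cutoff `K₀ + K + 1`, top length
`K₀ + K + 1`), the fresh events read through the flow-free truncation `truncShift` of the LENGTH-`(i+1)` sequence at level `i` (`truncShift_Λ`: `Λ′_ℓ = blockDownSet Λ_{ℓ+1}`,
so the level-`ℓ` event reads `Λ_{ℓ+1}, Λ_ℓ` — read-out length `len i = i + 1` in §2).  Hypotheses (T_B) (telescoping below `K₀ + K + 1`) and (O_B) (one-step letters on the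
sequences of length `i + 1`, `i ∈ [1, j]`); conclusion = gen 35's hPB for `(B, a)`. [bookkeeping] -/
theorem jointFreshSeqLetters_B_of_oneStep (hM : 0 < θ.τ9.M) (K : ℕ) (t : ℝ) {j : ℕ} (hjK : j ≤ K₀ + K) (B : Finset (Site (F.P (K₀ + K)) (lv K j)))
    {a : (b : Site (F.P (K₀ + K)) (lv K j)) → b ∈ B → (Σ i : ℕ, Site (F.P (K₀ + K)) (lv K i))}
    (ha : ∀ b (hb : b ∈ B), (a b hb).1 ∈ Finset.Icc 1 j) {ζ : ℕ → ℕ → ℕ → ℝ} (hζ0 : ∀ i, 0 ≤ ζ K j i)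
    (hT : ∀ m, m < K₀ + K + 1 → ∀ π : SeqOfRecord F θ.ν θ.τ9.M (histB₁₃ θ K₀ g₀ K) (K₀ + K + 1) m,
      ∑ s' ∈ Finset.univ.filter (fun s' : SeqOfRecord F θ.ν θ.τ9.M (histB₁₃ θ K₀ g₀ K) (K₀ + K + 1) (m + 1) => s'.init = π),
        classWeightOfDatum₉ F N θ.toStage9Params (datumOfRecord₁₃CoPH F N θ hP) g₀ os (runB₁₃ F K₀ g₀ K) (histB₁₃ θ K₀ g₀ K) (m + 1) t s' =
      classWeightOfDatum₉ F N θ.toStage9Params (datumOfRecord₁₃CoPH F N θ hP) g₀ os (runB₁₃ F K₀ g₀ K) (histB₁₃ θ K₀ g₀ K) m t π)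
    (hO : ∀ i ∈ Finset.Icc 1 j,
      ∑ π ∈ Finset.univ.filter (fun π : SeqOfRecord F θ.ν θ.τ9.M (histB₁₃ θ K₀ g₀ K) (K₀ + K + 1) (i + 1) =>
          ∀ x ∈ B.attach, (a x.1 x.2).1 ≤ i →
            (↑(iterBlock (lv K (a x.1 x.2).1) (a x.1 x.2).2) : Set (Site (F.P (K₀ + K)) 0)) ⊆
                ((truncShift F θ.ν hM (histB₁₃ θ K₀ g₀ K) π).Λ (a x.1 x.2).1)ᶜ ∧
            (2 ≤ (a x.1 x.2).1 → (↑(iterBlock (lv K (a x.1 x.2).1) (a x.1 x.2).2) : Set (Site (F.P (K₀ + K)) 0)) ⊆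
                (truncShift F θ.ν hM (histB₁₃ θ K₀ g₀ K) π).Λ ((a x.1 x.2).1 - 1))),
        classWeightOfDatum₉ F N θ.toStage9Params (datumOfRecord₁₃CoPH F N θ hP) g₀ os (runB₁₃ F K₀ g₀ K) (histB₁₃ θ K₀ g₀ K) (i + 1) t π ≤
      (∏ x ∈ B.attach.filter (fun x => (a x.1 x.2).1 = i), ζ K j (a x.1 x.2).1) *
        ∑ π ∈ Finset.univ.filter (fun π : SeqOfRecord F θ.ν θ.τ9.M (histB₁₃ θ K₀ g₀ K) (K₀ + K + 1) (i + 1) =>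
            ∀ x ∈ B.attach, (a x.1 x.2).1 < i →
              (↑(iterBlock (lv K (a x.1 x.2).1) (a x.1 x.2).2) : Set (Site (F.P (K₀ + K)) 0)) ⊆
                  ((truncShift F θ.ν hM (histB₁₃ θ K₀ g₀ K) π).Λ (a x.1 x.2).1)ᶜ ∧
              (2 ≤ (a x.1 x.2).1 → (↑(iterBlock (lv K (a x.1 x.2).1) (a x.1 x.2).2) : Set (Site (F.P (K₀ + K)) 0)) ⊆
                  (truncShift F θ.ν hM (histB₁₃ θ K₀ g₀ K) π).Λ ((a x.1 x.2).1 - 1))),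
          classWeightOfDatum₉ F N θ.toStage9Params (datumOfRecord₁₃CoPH F N θ hP) g₀ os (runB₁₃ F K₀ g₀ K) (histB₁₃ θ K₀ g₀ K) (i + 1) t π) :
    ∑ s' ∈ Finset.univ.filter (fun s' : SeqOfRecord F θ.ν θ.τ9.M (histB₁₃ θ K₀ g₀ K) (K₀ + K + 1) (K₀ + K + 1) =>
        ∀ x ∈ B.attach, (↑(iterBlock (lv K (a x.1 x.2).1) (a x.1 x.2).2) : Set (Site (F.P (K₀ + K)) 0)) ⊆
            ((truncShift F θ.ν hM (histB₁₃ θ K₀ g₀ K) s').Λ (a x.1 x.2).1)ᶜ ∧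
          (2 ≤ (a x.1 x.2).1 → (↑(iterBlock (lv K (a x.1 x.2).1) (a x.1 x.2).2) : Set (Site (F.P (K₀ + K)) 0)) ⊆
            (truncShift F θ.ν hM (histB₁₃ θ K₀ g₀ K) s').Λ ((a x.1 x.2).1 - 1))),
      classWeightOfDatum₉ F N θ.toStage9Params (datumOfRecord₁₃CoPH F N θ hP) g₀ os (runB₁₃ F K₀ g₀ K) (histB₁₃ θ K₀ g₀ K) (K₀ + K + 1) t s' ≤
    (∏ x ∈ B.attach, ζ K j (a x.1 x.2).1) * ∑ s' : SeqOfRecord F θ.ν θ.τ9.M (histB₁₃ θ K₀ g₀ K) (K₀ + K + 1) (K₀ + K + 1),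
      classWeightOfDatum₉ F N θ.toStage9Params (datumOfRecord₁₃CoPH F N θ hP) g₀ os (runB₁₃ F K₀ g₀ K) (histB₁₃ θ K₀ g₀ K) (K₀ + K + 1) t s' := by
  have ha1 : ∀ x ∈ B.attach, 1 ≤ (a x.1 x.2).1 ∧ (a x.1 x.2).1 ≤ j := fun x _ => Finset.mem_Icc.1 (ha x.1 x.2)
  -- the pins' fresh predicate on a run-B sequence of any length `m`, one level up through `blockDownSet` (`truncShift_Λ` when `m = m′ + 1`)
  let fr : (m : ℕ) → SeqOfRecord F θ.ν θ.τ9.M (histB₁₃ θ K₀ g₀ K) (K₀ + K + 1) m → {x // x ∈ B} → Prop := fun m s x =>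
    (↑(iterBlock (lv K (a x.1 x.2).1) (a x.1 x.2).2) : Set (Site (F.P (K₀ + K)) 0)) ⊆ (blockDownSet F (K₀ + K) (s.Λ ((a x.1 x.2).1 + 1)))ᶜ ∧
      (2 ≤ (a x.1 x.2).1 → (↑(iterBlock (lv K (a x.1 x.2).1) (a x.1 x.2).2) : Set (Site (F.P (K₀ + K)) 0)) ⊆
        blockDownSet F (K₀ + K) (s.Λ ((a x.1 x.2).1 - 1 + 1)))
  -- reading the truncation of a sequence of length `m + 1` at the levels of a pin of level `≤ m`
  have hev : ∀ {m : ℕ} (π : SeqOfRecord F θ.ν θ.τ9.M (histB₁₃ θ K₀ g₀ K) (K₀ + K + 1) (m + 1)), ∀ x ∈ B.attach, (a x.1 x.2).1 ≤ m →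
      (((↑(iterBlock (lv K (a x.1 x.2).1) (a x.1 x.2).2) : Set (Site (F.P (K₀ + K)) 0)) ⊆
            ((truncShift F θ.ν hM (histB₁₃ θ K₀ g₀ K) π).Λ (a x.1 x.2).1)ᶜ ∧
          (2 ≤ (a x.1 x.2).1 → (↑(iterBlock (lv K (a x.1 x.2).1) (a x.1 x.2).2) : Set (Site (F.P (K₀ + K)) 0)) ⊆
            (truncShift F θ.ν hM (histB₁₃ θ K₀ g₀ K) π).Λ ((a x.1 x.2).1 - 1))) ↔ fr (m + 1) π x) := by
    intro m π x hx hxm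
    have h1 := (ha1 x hx).1
    simp only [fr]
    rw [truncShift_Λ F θ.ν hM (histB₁₃ θ K₀ g₀ K) π h1 hxm]
    by_cases h2 : 2 ≤ (a x.1 x.2).1
    · rw [truncShift_Λ F θ.ν hM (histB₁₃ θ K₀ g₀ K) π (by omega) (by omega)]
    · simp only [h2, false_implies]
  have hgen := sum_le_prod_mul_of_oneStepLetters (j := j) (kt := K₀ + K + 1)
    (fun m (s : SeqOfRecord F θ.ν θ.τ9.M (histB₁₃ θ K₀ g₀ K) (K₀ + K + 1) m) =>
      classWeightOfDatum₉ F N θ.toStage9Params (datumOfRecord₁₃CoPH F N θ hP) g₀ os (runB₁₃ F K₀ g₀ K) (histB₁₃ θ K₀ g₀ K) m t s)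
    (fun i => i + 1) (fun _ _ h => Nat.succ_le_succ h) (Nat.succ_le_succ hjK) hT B.attach (fun x => (a x.1 x.2).1) ha1 fr
    (fun hnm s x hx hxn => by
      -- decided by the restriction to length `n ≥ i_b + 1`
      have h1 := (ha1 x hx).1
      simp only [fr]
      rw [Seq.restrict_Λ hnm s (by omega) hxn]
      by_cases h2 : 2 ≤ (a x.1 x.2).1
      · rw [Seq.restrict_Λ hnm s (by omega) (by omega)]
      · simp only [h2, false_implies])
    (fun x _ => hζ0 (a x.1 x.2).1)
    (fun m n => Finset.univ.filter (fun s : SeqOfRecord F θ.ν θ.τ9.M (histB₁₃ θ K₀ g₀ K) (K₀ + K + 1) m =>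
      ∀ x ∈ B.attach, (a x.1 x.2).1 ≤ n → fr m s x))
    (fun m n s => by simp only [Finset.mem_filter, Finset.mem_univ, true_and])
    (fun i hi => by
      -- the one-step letter at level `i`, its events rewritten through `truncShift_Λ`
      have hi1 : 1 ≤ i := (Finset.mem_Icc.1 hi).1
      have hL : Finset.univ.filter (fun π : SeqOfRecord F θ.ν θ.τ9.M (histB₁₃ θ K₀ g₀ K) (K₀ + K + 1) (i + 1) =>
            ∀ x ∈ B.attach, (a x.1 x.2).1 ≤ i →
              (↑(iterBlock (lv K (a x.1 x.2).1) (a x.1 x.2).2) : Set (Site (F.P (K₀ + K)) 0)) ⊆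
                  ((truncShift F θ.ν hM (histB₁₃ θ K₀ g₀ K) π).Λ (a x.1 x.2).1)ᶜ ∧
              (2 ≤ (a x.1 x.2).1 → (↑(iterBlock (lv K (a x.1 x.2).1) (a x.1 x.2).2) : Set (Site (F.P (K₀ + K)) 0)) ⊆
                  (truncShift F θ.ν hM (histB₁₃ θ K₀ g₀ K) π).Λ ((a x.1 x.2).1 - 1))) =
          Finset.univ.filter (fun π : SeqOfRecord F θ.ν θ.τ9.M (histB₁₃ θ K₀ g₀ K) (K₀ + K + 1) (i + 1) =>
            ∀ x ∈ B.attach, (a x.1 x.2).1 ≤ i → fr (i + 1) π x) :=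
        Finset.filter_congr fun π _ => forall₂_congr fun x hx => imp_congr_right fun hxi => hev π x hx hxi
      have hR : Finset.univ.filter (fun π : SeqOfRecord F θ.ν θ.τ9.M (histB₁₃ θ K₀ g₀ K) (K₀ + K + 1) (i + 1) =>
            ∀ x ∈ B.attach, (a x.1 x.2).1 < i →
              (↑(iterBlock (lv K (a x.1 x.2).1) (a x.1 x.2).2) : Set (Site (F.P (K₀ + K)) 0)) ⊆
                  ((truncShift F θ.ν hM (histB₁₃ θ K₀ g₀ K) π).Λ (a x.1 x.2).1)ᶜ ∧
              (2 ≤ (a x.1 x.2).1 → (↑(iterBlock (lv K (a x.1 x.2).1) (a x.1 x.2).2) : Set (Site (F.P (K₀ + K)) 0)) ⊆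
                  (truncShift F θ.ν hM (histB₁₃ θ K₀ g₀ K) π).Λ ((a x.1 x.2).1 - 1))) =
          Finset.univ.filter (fun π : SeqOfRecord F θ.ν θ.τ9.M (histB₁₃ θ K₀ g₀ K) (K₀ + K + 1) (i + 1) =>
            ∀ x ∈ B.attach, (a x.1 x.2).1 ≤ i - 1 → fr (i + 1) π x) :=
        Finset.filter_congr fun π _ => forall₂_congr fun x hx => by
          constructor
          · exact fun h hxi => (hev π x hx (by omega)).1 (h (by omega))
          · exact fun h hxi => (hev π x hx hxi.le).2 (h (by omega))
      rw [← hL, ← hR]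
      exact hO i hi)
  -- the top class, read through `truncShift_Λ` at the top length `K₀ + K + 1`
  refine le_trans (le_of_eq (Finset.sum_congr (Finset.filter_congr fun s' _ => ?_) fun _ _ => rfl)) hgen
  exact forall₂_congr fun x hx =>
    ⟨fun h _ => (hev s' x hx ((ha1 x hx).2.trans hjK)).1 h, fun h => (hev s' x hx ((ha1 x hx).2.trans hjK)).2 (h (ha1 x hx).2)⟩

end Runs

end YMDAG.UVSplit

end
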